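import Literature.AlgebraicGeometry.Motives.AbelianVarietyConjugateEtaleH1Transport
import Literature.AlgebraicGeometry.Motives.AbelianVarietyConjugateComp
import Literature.NumberTheory.DiophantineGeometry.AVGaloisModule
import Literature.NumberTheory.DiophantineGeometry.AVIsogenyTate
import HarnessLib

/-!
# The double `σ̃`-transport, read back through `(A^γ)^γ ≅ A`, is the Galois action of `σ̃²`
# (Shimura 1998 §18.6; Milne 2005 §11–§12; Serre–Tate 1968 §1)

Topic `Literature/AlgebraicGeometry/Motives`, namespace `Literature.AlgebraicGeometry.Motives.AbelianVariety`.
ONE definition with body (`sqLift`, the Galois element `σ̃² ∈ Gal(K̄/K)`) and THEOREMS, all proved; no named fact, no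
instance, no `sorry` (net Literature debt 0).  Generic leaf of the `AbelianVarietyConjugate*` family (★
`AbelianVarietyConjugateTransport`: `conjTransport`, `conjTransportTateEquiv`; ★ `AbelianVarietyConjugateEtaleH1Transport`:
`conjTransportRatTateEquiv`; ★ `AbelianVarietyConjugateComp`: the double-conjugate isomorphisms).  Statements = the SPEC LETTER of
A-p15 (g12) (`A-provers/A-p15/g12/AbelianVarietyConjugateTransportComp.spec.A-p15g12.lean` sha16 8090ead3a78eb318) TOKEN FOR TOKEN.

SETTING (all ★): `K` a field, `γ : K ≃+* K` an INVOLUTION (`hγ : ∀ x, γ (γ x) = x`), `σ̃ : K̄ ≃+* K̄` a lift of `γ`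
(`hσa : σ̃ ∘ ι = ι ∘ γ`), `A : AbelianVariety K`, a prime `ℓ`.  Since `γ² = 1`, `σ̃²` is `K`-linear: `sqLift σ̃ ∈ Gal(K̄/K)`.

* `geomPointsMap_conjTransport_conjTransport` — for any `d : (A^γ)^γ ≅ A` whose underlying scheme map is the double first
  projection (the `d` of ★ `exists_iso_conjugate_conjugate` (i) at `ρ = refl` with ★ `exists_iso_conjugate_refl`):
  `d ((x^σ̃)^σ̃) = σ̃² • x` on `A(K̄)` — both sides lie over `Spec σ̃ ≫ Spec σ̃ ≫ x = Spec(σ̃²) ≫ x`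
  (★ `conjTransport_left_comp_fst` twice; the tree's LEFT action `σ • P = Spec σ ≫ P`, ★ `AlgPoints.specMap_left`).
* `tateModuleMap_conjTransportTateEquiv_conjTransportTateEquiv` — the same on `T_ℓ`, componentwise (`TateModule.ext`).
* `rationalTateModuleMap_conjTransportRatTateEquiv_conjTransportRatTateEquiv` — the consumer's form on `V_ℓ`:
  `V_ℓ(d) ∘ H_{A^γ} ∘ H_A = ρ_{A,ℓ}(σ̃²)` (`ℚ_ℓ ⊗_{ℤ_ℓ}` of the `T_ℓ` identity; `rationalTateRep = (tateRep).baseChange` by `rfl`).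

WHY (cell `hodgecm-mathlib`, D-0151; consumer = the d6 line of crux `HLiu418` = stmt-HodgeConjecture-24832, bridge
`S1bShape_M → S1bShape`, A-p15 (g12) CENSUS-B3 §1): a quotient of the twisted Albanese `A_M^c` is turned into a quotient of `A_M`
through `(A_M^c)^c ≅ A_M`, and the K2 tower isomorphism meets exactly the composite computed here.  COUNT-NEUTRAL: HC_CM is proved
only modulo the 7 printed citations until rung 0 closes; nothing here mentions it.

## References
* [Shimura1998] G. Shimura, *Abelian Varieties with Complex Multiplication and Modular Functions* (1998), §18.6 proof of Thm. 18.6,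
  p. 129 («`x ↦ x^σ`», `(Y^σ)~ = Ỹ^f`).
* [Milne2005ShimuraVarieties] J. S. Milne, *Introduction to Shimura varieties* (2005), §11 p. 108 (the functor `σ`), §12 (55).
* [SerreTate1968] J.-P. Serre, J. Tate, *Good reduction of abelian varieties*, Ann. of Math. 88 (1968), §1 (`T_ℓ`, `V_ℓ` as Galois modules).
* [GortzWedhorn2020] U. Görtz, T. Wedhorn, *Algebraic Geometry I* (2nd ed. 2020), Prop. 4.16 (transitivity of base change).
-/

set_option autoImplicit false

noncomputable section

open CategoryTheory AlgebraicGeometry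
open Literature.NumberTheory.EllipticCurves (TateModule)

namespace Literature.AlgebraicGeometry.Motives.AbelianVariety

variable {K : Type} [Field K] (γ : K ≃+* K) (σt : AlgebraicClosure K ≃+* AlgebraicClosure K)
  (hσa : ∀ a : K, σt (algebraMap K (AlgebraicClosure K) a) = algebraMap K (AlgebraicClosure K) (γ a))
  (hγ : ∀ x : K, γ (γ x) = x)

/-- **`σ̃²` as an element of `Gal(K̄/K)`**: for a lift `σ̃ ∈ Aut(K̄)` of an involution `γ ∈ Aut(K)`, the square `σ̃ ∘ σ̃` fixes `K`
(`σ̃²(ι a) = ι(γ² a) = ι a`), hence is a `K`-algebra automorphism of `K̄`.  (The Galois element by which the double transport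
`x ↦ (x^σ̃)^σ̃` acts once `(A^γ)^γ` is identified with `A`.) [cite: Milne2005ShimuraVarieties, §11 p. 108 (the functor σ) and §12 (55)] -/
def sqLift : Field.absoluteGaloisGroup K :=
  AlgEquiv.ofRingEquiv (f := σt.trans σt) fun a => by
    change σt (σt (algebraMap K (AlgebraicClosure K) a)) = algebraMap K (AlgebraicClosure K) a
    rw [hσa, hσa, hγ]

/-- Unfolding `sqLift`: it acts on `K̄` as `σ̃ ∘ σ̃`. [cite: Milne2005ShimuraVarieties, §11 p. 108 (the functor σ)] -/
theorem sqLift_smul (y : AlgebraicClosure K) : sqLift γ σt hσa hγ • y = σt (σt y) := rfl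

/-- `Spec` of `σ̃²` (as used by the Galois action on geometric points) is `Spec σ̃ ≫ Spec σ̃` (functoriality of `Spec`).
[cite: GortzWedhorn2020, Prop. 4.16 and §(4.7)] -/
theorem specMap_sqLift_left :
    (AlgPoints.specMap (Field.absoluteGaloisGroup.toAlgEquiv K (sqLift γ σt hσa hγ))).left =
      Spec.map (CommRingCat.ofHom σt.toRingHom) ≫ Spec.map (CommRingCat.ofHom σt.toRingHom) := by
  rw [AlgPoints.specMap_left, ← Spec.map_comp, ← CommRingCat.ofHom_comp]
  congr 2

variable (A : AbelianVariety K) (ℓ : ℕ) [Fact ℓ.Prime]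

/-- **Points level: the double transport read back through `d : (A^γ)^γ ≅ A` is the Galois translate by `σ̃²`.**
For any isomorphism `d` whose underlying scheme map is the double first projection `(A^γ)^γ → A^γ → A` (the `d` of
★ `exists_iso_conjugate_conjugate` (i) at `ρ = refl` composed with ★ `exists_iso_conjugate_refl`), and every geometric point `x` of `A`:
`d((x^σ̃)^σ̃) = σ̃² • x`.  Proof: both are `K̄`-points of `A` over `Spec σ̃ ≫ Spec σ̃ ≫ x` — the left by ★ `conjTransport_left_comp_fst`
twice and `hd`, the right by the tree's LEFT Galois action `σ • P = Spec σ ≫ P` (★ `AlgPoints.specMap_left`).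
[cite: Shimura1998, §18.6 proof of Thm. 18.6, p. 129] [cite: Milne2005ShimuraVarieties, §11 p. 108] -/
theorem geomPointsMap_conjTransport_conjTransport
    (d : (A.conjugate γ).conjugate γ ≅ A)
    (hd : Hom.toSchemeHom d.hom = baseChangeHomFst γ.toRingHom (A.conjugate γ).X ≫ baseChangeHomFst γ.toRingHom A.X)
    (x : A.geomPoints) :
    Hom.geomPointsMap d.hom
        (conjTransport γ σt hσa (A.conjugate γ) (conjTransport γ σt hσa A x)) = sqLift γ σt hσa hγ • x := by
  apply Additive.toMul.injective
  apply Over.OverMorphism.ext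
  -- left: `((x^σ̃)^σ̃).left ≫ d = ((x^σ̃)^σ̃).left ≫ pr ≫ pr = Spec σ̃ ≫ (x^σ̃).left ≫ pr = Spec σ̃ ≫ Spec σ̃ ≫ x.left`
  change (Additive.toMul (conjTransport γ σt hσa (A.conjugate γ) (conjTransport γ σt hσa A x))).left ≫
      Hom.toSchemeHom d.hom = _
  rw [hd]
  refine (Category.assoc _ _ _).symm.trans ?_
  refine (eq_whisker (conjTransport_left_comp_fst γ σt hσa (A.conjugate γ) (conjTransport γ σt hσa A x)) _).trans ?_
  refine (Category.assoc _ _ _).trans ?_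
  refine (whisker_eq _ (conjTransport_left_comp_fst γ σt hσa A x)).trans ?_
  -- right: `(σ̃² • x).left = Spec(σ̃²) ≫ x.left = Spec σ̃ ≫ Spec σ̃ ≫ x.left`
  symm
  rw [AbelianVariety.toMul_smul, AlgPoints.absoluteGaloisGroup_smul_def, Over.comp_left, specMap_sqLift_left]
  exact Category.assoc _ _ _

/-- **`T_ℓ` level: `T_ℓ(d) (E_{A^γ} (E_A a)) = ρ_{A,ℓ}(σ̃²) a`**, componentwise from the points statement
(★ `proj_conjTransportTateEquiv`, ★ `proj_tateModuleMap`, `TateModule.ext`). [cite: Shimura1998, §18.6 proof of Thm. 18.6, p. 129] [cite: SerreTate1968, §1] -/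
theorem tateModuleMap_conjTransportTateEquiv_conjTransportTateEquiv
    (d : (A.conjugate γ).conjugate γ ≅ A)
    (hd : Hom.toSchemeHom d.hom = baseChangeHomFst γ.toRingHom (A.conjugate γ).X ≫ baseChangeHomFst γ.toRingHom A.X)
    (a : A.tateModule ℓ) :
    tateModuleMap ℓ d.hom
        (conjTransportTateEquiv γ σt hσa (A.conjugate γ) ℓ (conjTransportTateEquiv γ σt hσa A ℓ a)) =
      A.tateRep ℓ (sqLift γ σt hσa hγ) a :=
  TateModule.ext fun n => by
    rw [proj_tateModuleMap, proj_conjTransportTateEquiv, proj_conjTransportTateEquiv, tateRep_apply_apply,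
      TateModule.proj_smul_of_distribMulAction, geomPointsMap_conjTransport_conjTransport γ σt hσa hγ A d hd]

/-- **`V_ℓ` level (the consumer's form): `V_ℓ(d) ∘ H_{A^γ} ∘ H_A = ρ_{A,ℓ}(σ̃²)`** on `V_ℓ A = ℚ_ℓ ⊗_{ℤ_ℓ} T_ℓ A` — the base
change of the `T_ℓ` identity (`rationalTateModuleMap = (tateModuleMap).baseChange`, ★ `coe_conjTransportRatTateEquiv`,
`rationalTateRep = (tateRep).baseChange` by `rfl`). [cite: Shimura1998, §18.6 proof of Thm. 18.6, p. 129] [cite: SerreTate1968, §1] -/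
theorem rationalTateModuleMap_conjTransportRatTateEquiv_conjTransportRatTateEquiv
    (d : (A.conjugate γ).conjugate γ ≅ A)
    (hd : Hom.toSchemeHom d.hom = baseChangeHomFst γ.toRingHom (A.conjugate γ).X ≫ baseChangeHomFst γ.toRingHom A.X)
    (v : A.rationalTateModule ℓ) :
    rationalTateModuleMap ℓ d.hom
        (conjTransportRatTateEquiv γ σt hσa (A.conjugate γ) ℓ (conjTransportRatTateEquiv γ σt hσa A ℓ v)) =
      A.rationalTateRep ℓ (sqLift γ σt hσa hγ) v := by
  have hT : tateModuleMap ℓ d.hom ∘ₗ ((conjTransportTateEquiv γ σt hσa (A.conjugate γ) ℓ).toLinearMap ∘ₗ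
      (conjTransportTateEquiv γ σt hσa A ℓ).toLinearMap) = A.tateRep ℓ (sqLift γ σt hσa hγ) := by
    apply LinearMap.ext
    intro a
    simp only [LinearMap.coe_comp, Function.comp_apply, LinearEquiv.coe_coe]
    exact tateModuleMap_conjTransportTateEquiv_conjTransportTateEquiv γ σt hσa hγ A ℓ d hd a
  have key : ((tateModuleMap ℓ d.hom).baseChange ℚ_[ℓ]).comp
        (((conjTransportTateEquiv γ σt hσa (A.conjugate γ) ℓ).toLinearMap.baseChange ℚ_[ℓ]).comp
          ((conjTransportTateEquiv γ σt hσa A ℓ).toLinearMap.baseChange ℚ_[ℓ])) =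
      (A.tateRep ℓ (sqLift γ σt hσa hγ)).baseChange ℚ_[ℓ] := by
    rw [← LinearMap.baseChange_comp, ← LinearMap.baseChange_comp, hT]
  exact LinearMap.congr_fun key v

end Literature.AlgebraicGeometry.Motives.AbelianVariety

end
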